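import Summits.QuantumFields.YangMills.Theorems.BalabanLadderIRAfOnsetDoubleSums
import Summits.QuantumFields.YangMills.Theorems.BalabanLadderIRAfOnsetTails
import Summits.QuantumFields.YangMills.Theorems.BalabanLadderIRAfOnsetCovariance
import HarnessLib

/-!
# Crux `IRcof` (stmt-QuantumFields-26930) — LINE «running-landmark», helper (J) part 1∕2: the bookkeeping KIT of the
# junction lemma `pin_of_window` (geometry of `ℤ⁴`, the termwise NEAR∕FAR∕TAIL split, torus size, dyadic shell, numerics)

Helper for `Summit.QuantumFields.YangMills.Theses.BalabanLadder.IRcof` (stmt-QuantumFields-26930; `--supports … --as helper`).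
Census row 48, line «running-landmark» (ideator ym-ir-idea-24 g0; workfile `Cruxes/IRcof/Lines/running_landmark.lean`
81d9d3aed4c37d82; vocabulary landed as `Theorems/IR/RunningLandmarkDefs.lean` p666269; critic ym-ir-crit-3 g3
`VERDICT-running-landmark-idea24-crit3-g3.md` 2026-08-28T20:34Z PASS-WITH-PRICE, «KEY (№34): ONE helper — prove `stub_pin` (J)
… pool-p3; size M»).  Part 2 (`Theorems/BalabanLadderIRcofRunningLandmarkPin.lean`) proves (J)
`pin_of_window : RunningWindow → HyperscalingEnvelope → PinnedThaw`; this part is its elementary kit (no Yang–Mills content,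
no definition, no named fact):

* §J1 `ℤ⁴` geometry: `‖z‖_∞ ≤ ‖z‖₂` (`norm_le_norm_siteToE`; `‖z‖₂ ≤ 2‖z‖_∞` is the tree's
  `StrongCouplingIRTrivial.norm_siteToE_le`), `1 ≤ ‖z‖_∞` for `z ≠ 0`,
  `mem_box_of_norm_le`, and the three kernel conversions to the envelope form `(1 + ‖w‖_∞)⁻⁸` used by parent family A's
  double-sum estimates (`div_norm_siteToE_pow_le`, `div_pow_le_of_norm_le`, `le_div_pow_of_norm_lt`);
* §J2 the termwise split `abs_term_le_split` ∕ `abs_doubleSum_le_split` of `|F(s x) G(s y) Cov(x,y)|` into NEAR (in-ball,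
  `a‖x−y‖ ≤ D`), FAR (in-ball, `D < a‖x−y‖`) and the two TAILS (`‖x‖ > N` or `‖y‖ > N`), with the tail factorisations;
* §J3 `exists_torus_size` (one torus size above finitely many thresholds), `exists_shell` (the dyadic shell `n ≤ ‖w‖₂ ≤ 2n` of a
  lag), `cov_window_bound` ∕ `cov_far_bound` (the (RW) ∕ (H) bounds in envelope form), and the numerics of the four pieces
  (`short_piece_le`, `window_piece_le`, `far_piece_le'`, `tails_piece_le`, `div_le_eighth`, `div_le_sixteenth`).

HONEST FRAMING: elementary real analysis ∕ bookkeeping (folklore); width toward PXcof ∕ `IRcof` ∕ `IR`: 0; nothing here proves the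
Yang–Mills mass gap (Clay) — NOT proved; R4 closes only the conditional finite-𝕋⁴ rung `BalabanLadder.UV`.
-/

set_option autoImplicit false

noncomputable section

open Filter Topology MeasureTheory Finset
open scoped BigOperators SchwartzMap
open Literature.MathematicalPhysics.QuantumFieldTheory hiding ZdEdge
open Literature.MathematicalPhysics.QuantumLattice
open Literature.Probability.LatticeModels (Site)

namespace Summit.QuantumFields.YangMills.Cruxes.IRcof.RunningLandmark

/-! ## §J1 Geometry of `ℤ⁴`: sup norm versus Euclidean norm, integrality -/

section Geometry

open Literature.Probability.LatticeModels (box mem_box)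

/-- `‖z‖_∞ ≤ ‖z‖₂` for `z ∈ ℤ⁴` (`siteToE z` is `z` read in `ℝ⁴`). -/
theorem norm_le_norm_siteToE (z : Site 4) : ‖z‖ ≤ ‖siteToE z‖ := by
  have h := Summit.QuantumFields.YangMills.Theorems.OSLegsFromFemtoAndGap.mul_norm_le_norm_smul_siteToE
    (a := (1 : ℝ)) zero_le_one z
  simpa using h

/-- A nonzero point of `ℤ⁴` has sup norm `≥ 1`. -/
theorem one_le_norm_of_ne_zero {z : Site 4} (hz : z ≠ 0) : 1 ≤ ‖z‖ := by
  obtain ⟨i, hi⟩ : ∃ i, z i ≠ 0 := by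
    by_contra h
    push Not at h
    exact hz (funext h)
  have h1 : (1 : ℝ) ≤ ‖z i‖ := by
    rw [Int.norm_eq_abs]
    exact_mod_cast Int.one_le_abs hi
  exact h1.trans (norm_le_pi_norm z i)

/-- A point of sup norm `≤ n` lies in `box 4 n`. -/
theorem mem_box_of_norm_le {z : Site 4} {n : ℕ} (h : ‖z‖ ≤ n) : z ∈ box 4 n := by
  rw [mem_box]
  intro i
  have hi : ‖z i‖ ≤ n := (norm_le_pi_norm z i).trans h
  rw [Int.norm_eq_abs] at hi
  have hi' : |z i| ≤ (n : ℤ) := by exact_mod_cast hi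
  exact ⟨by linarith [(abs_le.1 hi').1], (abs_le.1 hi').2⟩

/-- **Kernel conversion for the envelope**: for `w ≠ 0` and `C ≥ 0`, `C / ‖w‖₂⁸ ≤ 2⁸ C / (1 + ‖w‖_∞)⁸`. -/
theorem div_norm_siteToE_pow_le {w : Site 4} (hw : w ≠ 0) {C : ℝ} (hC : 0 ≤ C) :
    C / ‖siteToE w‖ ^ 8 ≤ 2 ^ 8 * C / (1 + ‖w‖) ^ 8 := by
  have h1 : 1 ≤ ‖w‖ := one_le_norm_of_ne_zero hw
  have h2 : ‖w‖ ≤ ‖siteToE w‖ := norm_le_norm_siteToE w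
  have hpos : 0 < ‖siteToE w‖ := lt_of_lt_of_le one_pos (h1.trans h2)
  have h3 : 1 + ‖w‖ ≤ 2 * ‖siteToE w‖ := by linarith
  have h4 : (1 + ‖w‖) ^ 8 ≤ 2 ^ 8 * ‖siteToE w‖ ^ 8 := by
    calc (1 + ‖w‖) ^ 8 ≤ (2 * ‖siteToE w‖) ^ 8 := pow_le_pow_left₀ (by positivity) h3 8
      _ = 2 ^ 8 * ‖siteToE w‖ ^ 8 := by ring
  rw [div_le_div_iff₀ (by positivity) (by positivity)]
  calc C * (1 + ‖w‖) ^ 8 ≤ C * (2 ^ 8 * ‖siteToE w‖ ^ 8) := mul_le_mul_of_nonneg_left h4 hC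
    _ = 2 ^ 8 * C * ‖siteToE w‖ ^ 8 := by ring

/-- **Kernel conversion for the window**: if `‖w‖₂ ≤ 2n` for a natural number `n ≥ 1`... precisely: for `w ≠ 0`, `0 < n` and
`‖siteToE w‖ ≤ 2 n`, `K / n⁸ ≤ 4⁸ K / (1 + ‖w‖_∞)⁸` (`K ≥ 0`). -/
theorem div_pow_le_of_norm_le {w : Site 4} (hw : w ≠ 0) {n K : ℝ} (hn : 0 < n) (hK : 0 ≤ K)
    (hwn : ‖siteToE w‖ ≤ 2 * n) : K / n ^ 8 ≤ 4 ^ 8 * K / (1 + ‖w‖) ^ 8 := by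
  have h1 : 1 ≤ ‖w‖ := one_le_norm_of_ne_zero hw
  have h2 : ‖w‖ ≤ ‖siteToE w‖ := norm_le_norm_siteToE w
  have h3 : 1 + ‖w‖ ≤ 4 * n := by linarith
  have h4 : (1 + ‖w‖) ^ 8 ≤ 4 ^ 8 * n ^ 8 := by
    calc (1 + ‖w‖) ^ 8 ≤ (4 * n) ^ 8 := pow_le_pow_left₀ (by positivity) h3 8
      _ = 4 ^ 8 * n ^ 8 := by ring
  rw [div_le_div_iff₀ (by positivity) (by positivity)]
  calc K * (1 + ‖w‖) ^ 8 ≤ K * (4 ^ 8 * n ^ 8) := mul_le_mul_of_nonneg_left h4 hK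
    _ = 4 ^ 8 * K * n ^ 8 := by ring

/-- **Kernel conversion at short lags**: if `‖siteToE w‖ < 8` then `B ≤ 9⁸ B / (1 + ‖w‖_∞)⁸` (`B ≥ 0`). -/
theorem le_div_pow_of_norm_lt {w : Site 4} {B : ℝ} (hB : 0 ≤ B) (hw8 : ‖siteToE w‖ < 8) :
    B ≤ 9 ^ 8 * B / (1 + ‖w‖) ^ 8 := by
  have h2 : ‖w‖ ≤ ‖siteToE w‖ := norm_le_norm_siteToE w
  have h3 : 1 + ‖w‖ ≤ 9 := by linarith
  have h4 : (1 + ‖w‖) ^ 8 ≤ 9 ^ 8 := pow_le_pow_left₀ (by positivity) h3 8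
  rw [le_div_iff₀ (by positivity)]
  calc B * (1 + ‖w‖) ^ 8 ≤ B * 9 ^ 8 := mul_le_mul_of_nonneg_left h4 hB
    _ = 9 ^ 8 * B := by ring

end Geometry

/-! ## §J2 The termwise split of `|F(s x) G(s y) Cov(x, y)|`: NEAR ∕ FAR inside the ball, trivial outside -/

section Split

open Literature.Probability.LatticeModels (box mem_box)

/-- **Termwise split.**  With `k8 = (1+‖x−y‖)⁻⁸`: if `|c| ≤ C₀` always, `|c| ≤ Wn k8` for in-ball NEAR pairs (`¬ D < s‖x−y‖`)
and `|c| ≤ Wf k8` for in-ball FAR pairs, then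
`|F G c| ≤ Wn|F||G|k8 + Wf·𝟙[D < s‖x−y‖]|F||G|k8 + C₀·𝟙[N < ‖x‖]|F||G| + C₀·𝟙[N < ‖y‖]|F||G|`. -/
theorem abs_term_le_split {F G : EuclideanSpace ℝ (Fin 4) → ℝ} {c s N Wn Wf C₀ D : ℝ}
    (hWn : 0 ≤ Wn) (hWf : 0 ≤ Wf) (hC₀ : 0 ≤ C₀) (x y : Site 4) (hcov : |c| ≤ C₀)
    (hnear : ‖x‖ ≤ N → ‖y‖ ≤ N → ¬ D < s * ‖x - y‖ → |c| ≤ Wn / (1 + ‖x - y‖) ^ 8)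
    (hfar : ‖x‖ ≤ N → ‖y‖ ≤ N → D < s * ‖x - y‖ → |c| ≤ Wf / (1 + ‖x - y‖) ^ 8) :
    |F (s • siteToE x) * G (s • siteToE y) * c| ≤
      Wn * (|F (s • siteToE x)| * |G (s • siteToE y)| * ((1 + ‖x - y‖) ^ 8)⁻¹) +
        Wf * (if D < s * ‖x - y‖ then |F (s • siteToE x)| * |G (s • siteToE y)| * ((1 + ‖x - y‖) ^ 8)⁻¹ else 0) +
        C₀ * (if N < ‖x‖ then |F (s • siteToE x)| * |G (s • siteToE y)| else 0) +
        C₀ * (if N < ‖y‖ then |F (s • siteToE x)| * |G (s • siteToE y)| else 0) := by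
  rw [abs_mul, abs_mul]
  have hFG : 0 ≤ |F (s • siteToE x)| * |G (s • siteToE y)| := by positivity
  have hk : 0 ≤ ((1 + ‖x - y‖) ^ 8)⁻¹ := by positivity
  have h0 : 0 ≤ Wn * (|F (s • siteToE x)| * |G (s • siteToE y)| * ((1 + ‖x - y‖) ^ 8)⁻¹) := by positivity
  have h1 : 0 ≤ Wf * (if D < s * ‖x - y‖ then |F (s • siteToE x)| * |G (s • siteToE y)| *
      ((1 + ‖x - y‖) ^ 8)⁻¹ else 0) := by
    split_ifs <;> positivity
  have h2 : 0 ≤ C₀ * (if N < ‖x‖ then |F (s • siteToE x)| * |G (s • siteToE y)| else 0) := by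
    split_ifs <;> positivity
  have h3 : 0 ≤ C₀ * (if N < ‖y‖ then |F (s • siteToE x)| * |G (s • siteToE y)| else 0) := by
    split_ifs <;> positivity
  have htriv : |F (s • siteToE x)| * |G (s • siteToE y)| * |c| ≤ C₀ * (|F (s • siteToE x)| * |G (s • siteToE y)|) := by
    calc |F (s • siteToE x)| * |G (s • siteToE y)| * |c| ≤ |F (s • siteToE x)| * |G (s • siteToE y)| * C₀ :=
          mul_le_mul_of_nonneg_left hcov hFG
      _ = _ := by ring
  by_cases hx : ‖x‖ ≤ N
  · by_cases hy : ‖y‖ ≤ N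
    · by_cases hD : D < s * ‖x - y‖
      · -- FAR, in the ball
        rw [if_pos hD] at h1 ⊢
        calc |F (s • siteToE x)| * |G (s • siteToE y)| * |c|
            ≤ |F (s • siteToE x)| * |G (s • siteToE y)| * (Wf / (1 + ‖x - y‖) ^ 8) :=
              mul_le_mul_of_nonneg_left (hfar hx hy hD) hFG
          _ = Wf * (|F (s • siteToE x)| * |G (s • siteToE y)| * ((1 + ‖x - y‖) ^ 8)⁻¹) := by ring
          _ ≤ _ := by linarith
      · -- NEAR, in the ball
        calc |F (s • siteToE x)| * |G (s • siteToE y)| * |c|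
            ≤ |F (s • siteToE x)| * |G (s • siteToE y)| * (Wn / (1 + ‖x - y‖) ^ 8) :=
              mul_le_mul_of_nonneg_left (hnear hx hy hD) hFG
          _ = Wn * (|F (s • siteToE x)| * |G (s • siteToE y)| * ((1 + ‖x - y‖) ^ 8)⁻¹) := by ring
          _ ≤ _ := by linarith
    · -- `y` outside the ball
      rw [not_le] at hy
      rw [if_pos hy] at h3 ⊢
      linarith
  · -- `x` outside the ball
    rw [not_le] at hx
    rw [if_pos hx] at h2 ⊢
    linarith

/-- **The split double sum**: summing `abs_term_le_split` over `X × Y`. -/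
theorem abs_doubleSum_le_split {F G : EuclideanSpace ℝ (Fin 4) → ℝ} (cov : Site 4 → Site 4 → ℝ)
    {s N Wn Wf C₀ D : ℝ} (hWn : 0 ≤ Wn) (hWf : 0 ≤ Wf) (hC₀ : 0 ≤ C₀) (X Y : Finset (Site 4))
    (hcov : ∀ x ∈ X, ∀ y ∈ Y, |cov x y| ≤ C₀)
    (hnear : ∀ x ∈ X, ∀ y ∈ Y, ‖x‖ ≤ N → ‖y‖ ≤ N → ¬ D < s * ‖x - y‖ → |cov x y| ≤ Wn / (1 + ‖x - y‖) ^ 8)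
    (hfar : ∀ x ∈ X, ∀ y ∈ Y, ‖x‖ ≤ N → ‖y‖ ≤ N → D < s * ‖x - y‖ → |cov x y| ≤ Wf / (1 + ‖x - y‖) ^ 8) :
    |∑ x ∈ X, ∑ y ∈ Y, F (s • siteToE x) * G (s • siteToE y) * cov x y| ≤
      Wn * ∑ x ∈ X, ∑ y ∈ Y, |F (s • siteToE x)| * |G (s • siteToE y)| * ((1 + ‖x - y‖) ^ 8)⁻¹ +
        Wf * ∑ x ∈ X, ∑ y ∈ Y,
          (if D < s * ‖x - y‖ then |F (s • siteToE x)| * |G (s • siteToE y)| * ((1 + ‖x - y‖) ^ 8)⁻¹ else 0) +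
        C₀ * ∑ x ∈ X, ∑ y ∈ Y, (if N < ‖x‖ then |F (s • siteToE x)| * |G (s • siteToE y)| else 0) +
        C₀ * ∑ x ∈ X, ∑ y ∈ Y, (if N < ‖y‖ then |F (s • siteToE x)| * |G (s • siteToE y)| else 0) := by
  calc |∑ x ∈ X, ∑ y ∈ Y, F (s • siteToE x) * G (s • siteToE y) * cov x y|
      ≤ ∑ x ∈ X, |∑ y ∈ Y, F (s • siteToE x) * G (s • siteToE y) * cov x y| := Finset.abs_sum_le_sum_abs _ _
    _ ≤ ∑ x ∈ X, ∑ y ∈ Y, |F (s • siteToE x) * G (s • siteToE y) * cov x y| :=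
        Finset.sum_le_sum fun x _ => Finset.abs_sum_le_sum_abs _ _
    _ ≤ ∑ x ∈ X, ∑ y ∈ Y,
          (Wn * (|F (s • siteToE x)| * |G (s • siteToE y)| * ((1 + ‖x - y‖) ^ 8)⁻¹) +
            Wf * (if D < s * ‖x - y‖ then
              |F (s • siteToE x)| * |G (s • siteToE y)| * ((1 + ‖x - y‖) ^ 8)⁻¹ else 0) +
            C₀ * (if N < ‖x‖ then |F (s • siteToE x)| * |G (s • siteToE y)| else 0) +
            C₀ * (if N < ‖y‖ then |F (s • siteToE x)| * |G (s • siteToE y)| else 0)) :=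
        Finset.sum_le_sum fun x hx => Finset.sum_le_sum fun y hy =>
          abs_term_le_split hWn hWf hC₀ x y (hcov x hx y hy) (hnear x hx y hy) (hfar x hx y hy)
    _ = _ := by simp only [Finset.sum_add_distrib, Finset.mul_sum]

/-- The TAIL sums factorise: `Σ_{x,y} 𝟙[N < ‖x‖]|F(s x)||G(s y)| = (Σ_{x : N < ‖x‖} |F(s x)|)(Σ_y |G(s y)|)`. -/
theorem sum_sum_ite_norm_fst {F G : EuclideanSpace ℝ (Fin 4) → ℝ} (s N : ℝ) (X Y : Finset (Site 4)) :
    ∑ x ∈ X, ∑ y ∈ Y, (if N < ‖x‖ then |F (s • siteToE x)| * |G (s • siteToE y)| else 0) =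
      (∑ x ∈ X.filter (fun x => N < ‖x‖), |F (s • siteToE x)|) * ∑ y ∈ Y, |G (s • siteToE y)| := by
  rw [Finset.sum_filter, Finset.sum_mul]
  refine Finset.sum_congr rfl fun x _ => ?_
  split_ifs with h
  · rw [Finset.mul_sum]
  · simp

/-- The second TAIL sum: `Σ_{x,y} 𝟙[N < ‖y‖]|F(s x)||G(s y)| = (Σ_x |F(s x)|)(Σ_{y : N < ‖y‖} |G(s y)|)`. -/
theorem sum_sum_ite_norm_snd {F G : EuclideanSpace ℝ (Fin 4) → ℝ} (s N : ℝ) (X Y : Finset (Site 4)) :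
    ∑ x ∈ X, ∑ y ∈ Y, (if N < ‖y‖ then |F (s • siteToE x)| * |G (s • siteToE y)| else 0) =
      (∑ x ∈ X, |F (s • siteToE x)|) * ∑ y ∈ Y.filter (fun y => N < ‖y‖), |G (s • siteToE y)| := by
  rw [Finset.sum_mul]
  refine Finset.sum_congr rfl fun x _ => ?_
  rw [Finset.sum_filter, Finset.mul_sum]
  refine Finset.sum_congr rfl fun y _ => ?_
  split_ifs <;> simp

end Split

/-! ## §J3 Bookkeeping lemmas for the junction: torus size, dyadic shell, covariance conversions, numerics -/

section Bookkeeping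

open Literature.Probability.LatticeModels (box mem_box)

/-- **One torus size meeting finitely many thresholds**: `L ≥ 1`, `Λ₅ ≤ s L`, `L ≥ SR n` on the dyadic range `8 ≤ n ≤ n_D`, and
`L ≥ SH w` for every lag `w ∈ box 4 (2 Nn)`. -/
theorem exists_torus_size (SR : ℕ → ℕ) (SH : Site 4 → ℕ) {s : ℝ} (hs : 0 < s) (Λ₅ : ℝ) (nD Nn : ℕ) :
    ∃ L : ℕ, 1 ≤ L ∧ Λ₅ ≤ s * L ∧ (∀ n, 8 ≤ n → n ≤ nD → SR n ≤ L) ∧ (∀ w ∈ box 4 (2 * Nn), SH w ≤ L) := by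
  classical
  obtain ⟨L, hL⟩ : ∃ L : ℕ, L = max (max (⌈Λ₅ / s⌉₊ + 1) ((Finset.Icc 8 nD).sup SR)) ((box 4 (2 * Nn)).sup SH) :=
    ⟨_, rfl⟩
  have hA : ⌈Λ₅ / s⌉₊ + 1 ≤ L := by rw [hL]; exact le_trans (le_max_left _ _) (le_max_left _ _)
  refine ⟨L, le_trans (Nat.le_add_left 1 _) hA, ?_, fun n h8 hn => ?_, fun w hw => ?_⟩
  · have h1 : Λ₅ / s ≤ (⌈Λ₅ / s⌉₊ : ℝ) := Nat.le_ceil _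
    have h3 : (⌈Λ₅ / s⌉₊ : ℝ) ≤ (L : ℝ) := by exact_mod_cast le_trans (Nat.le_succ _) hA
    rw [div_le_iff₀ hs] at h1
    calc Λ₅ ≤ (⌈Λ₅ / s⌉₊ : ℝ) * s := h1
      _ ≤ (L : ℝ) * s := mul_le_mul_of_nonneg_right h3 hs.le
      _ = s * L := mul_comm _ _
  · rw [hL]
    exact le_trans (Finset.le_sup (f := SR) (Finset.mem_Icc.2 ⟨h8, hn⟩)) (le_trans (le_max_right _ _) (le_max_left _ _))
  · rw [hL]
    exact le_trans (Finset.le_sup (f := SH) hw) (le_max_right _ _)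

/-- **The dyadic shell of a lag**: for `e ≥ 8` there is `n ≥ 8` with `n ≤ e ≤ 2n`, and `n ≤ m` whenever `m ≥ 8` and `e/2 ≤ m`
(`n = max 8 ⌈e/2⌉`). -/
theorem exists_shell {e : ℝ} (he : 8 ≤ e) :
    ∃ n : ℕ, 8 ≤ n ∧ (n : ℝ) ≤ e ∧ e ≤ 2 * n ∧ ∀ m : ℕ, 8 ≤ m → e / 2 ≤ (m : ℝ) → n ≤ m := by
  refine ⟨max 8 ⌈e / 2⌉₊, le_max_left _ _, ?_, ?_, fun m hm hem => max_le hm (Nat.ceil_le.2 hem)⟩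
  · rcases le_total 8 ⌈e / 2⌉₊ with hc | hc
    · rw [max_eq_right hc]
      have := Nat.ceil_lt_add_one (show 0 ≤ e / 2 by linarith)
      linarith
    · rw [max_eq_left hc]; exact_mod_cast he
  · have h1 : e / 2 ≤ ⌈e / 2⌉₊ := Nat.le_ceil _
    have h2 : (⌈e / 2⌉₊ : ℝ) ≤ ((max 8 ⌈e / 2⌉₊ : ℕ) : ℝ) := by exact_mod_cast le_max_right _ _
    linarith

/-- **WINDOW conversion**: from the running-window bound `|c| n⁸ ≤ K / log²r` at a shell `n` with `‖w‖₂ ≤ 2n`, a frozen ratio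
`0 < r < e^{−t}` (`t > 0`), to the kernel form `|c| ≤ 4⁸ (K/t²) / (1 + ‖w‖_∞)⁸`. -/
theorem cov_window_bound {w : Site 4} (hw : w ≠ 0) {c K t r : ℝ} {n : ℕ} (hK : 0 < K) (ht : 0 < t) (hn : 0 < n)
    (hr0 : 0 < r) (hrt : r < Real.exp (-t)) (hwn : ‖siteToE w‖ ≤ 2 * n)
    (hb : |c| * (n : ℝ) ^ 8 ≤ K / Real.log r ^ 2) : |c| ≤ 4 ^ 8 * (K / t ^ 2) / (1 + ‖w‖) ^ 8 := by
  have hlog : Real.log r < -t := by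
    have h1 := Real.log_lt_log hr0 hrt
    rwa [Real.log_exp] at h1
  have hlog2 : t ^ 2 ≤ Real.log r ^ 2 := by nlinarith
  have hn0 : (0 : ℝ) < n := by exact_mod_cast hn
  have h1 : |c| ≤ (K / t ^ 2) / (n : ℝ) ^ 8 := by
    rw [le_div_iff₀ (by positivity)]
    exact hb.trans (div_le_div_of_nonneg_left hK.le (by positivity) hlog2)
  exact h1.trans (div_pow_le_of_norm_le hw hn0 (by positivity) hwn)

/-- **FAR conversion**: from the envelope `|c| ‖w‖₂⁸ ≤ C_H` (`w ≠ 0`) to `|c| ≤ 2⁸ max(C_H,0) / (1 + ‖w‖_∞)⁸`. -/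
theorem cov_far_bound {w : Site 4} (hw : w ≠ 0) {c CH : ℝ} (hb : |c| * ‖siteToE w‖ ^ 8 ≤ CH) :
    |c| ≤ 2 ^ 8 * max CH 0 / (1 + ‖w‖) ^ 8 := by
  have hpos : 0 < ‖siteToE w‖ := lt_of_lt_of_le one_pos ((one_le_norm_of_ne_zero hw).trans (norm_le_norm_siteToE _))
  have h1 : |c| ≤ max CH 0 / ‖siteToE w‖ ^ 8 := by
    rw [le_div_iff₀ (by positivity)]
    exact hb.trans (le_max_left _ _)
  exact h1.trans (div_norm_siteToE_pow_le hw (le_max_right CH 0))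

/-- Numerics: `P / (8 P / ε + c) ≤ ε / 8` for `P ≥ 0`, `ε, c > 0`. -/
theorem div_le_eighth {P ε c : ℝ} (hP : 0 ≤ P) (hε : 0 < ε) (hc : 0 < c) : P / (8 * P / ε + c) ≤ ε / 8 := by
  have hden : 0 < 8 * P / ε + c := by positivity
  rw [div_le_div_iff₀ hden (by norm_num)]
  have h1 : ε * (8 * P / ε) = 8 * P := by field_simp
  nlinarith [mul_pos hε hc]

/-- Numerics: `P / (16 P / ε + 1) ≤ ε / 16` for `P ≥ 0`, `ε > 0`. -/
theorem div_le_sixteenth {P ε : ℝ} (hP : 0 ≤ P) (hε : 0 < ε) : P / (16 * P / ε + 1) ≤ ε / 16 := by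
  have hden : 0 < 16 * P / ε + 1 := by positivity
  rw [div_le_div_iff₀ hden (by norm_num)]
  have h1 : ε * (16 * P / ε) = 16 * P := by field_simp
  nlinarith

/-- Numerics of the SHORT lags: with `32·9⁸W₁J/ε + 1 ≤ β` (`β ≥ 1`, `J > 0`), `9⁸ (W₁ (1+log β)²/β²) J ≤ ε/8`. -/
theorem short_piece_le {W₁ J ε β : ℝ} (hW₁ : 0 ≤ W₁) (hJ : 0 < J) (hε : 0 < ε) (hβ1 : 1 ≤ β)
    (hβs : 32 * (9 ^ 8 * W₁ * J) / ε + 1 ≤ β) : 9 ^ 8 * (W₁ * (1 + Real.log β) ^ 2 / β ^ 2) * J ≤ ε / 8 := by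
  have hβ0 : 0 < β := lt_of_lt_of_le one_pos hβ1
  have hlog : (1 + Real.log β) ^ 2 / β ^ 2 ≤ 4 / β := by
    rw [div_le_div_iff₀ (by positivity) hβ0]
    have := Summit.QuantumFields.YangMills.Cruxes.IR.AfOnset.one_add_log_sq_le hβ1
    nlinarith
  have hWs' : 9 ^ 8 * (W₁ * (1 + Real.log β) ^ 2 / β ^ 2) ≤ 9 ^ 8 * W₁ * (4 / β) := by
    rw [mul_assoc, mul_div_assoc]
    exact mul_le_mul_of_nonneg_left (mul_le_mul_of_nonneg_left hlog hW₁) (by norm_num)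
  have h4 : 32 * (9 ^ 8 * W₁ * J) ≤ β * ε := by
    have h5 : 32 * (9 ^ 8 * W₁ * J) / ε ≤ β := by linarith
    rw [div_le_iff₀ hε] at h5
    exact h5
  have hkey : 9 ^ 8 * W₁ * (4 / β) * J ≤ ε / 8 := by
    rw [show 9 ^ 8 * W₁ * (4 / β) * J = (4 * (9 ^ 8 * W₁ * J)) / β by ring, div_le_div_iff₀ hβ0 (by norm_num)]
    linarith
  exact (mul_le_mul_of_nonneg_right hWs' hJ.le).trans hkey

/-- Numerics of the WINDOW: with `t² ≥ 8·4⁸KJ/ε`, `4⁸ (K/t²) J ≤ ε/8`. -/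
theorem window_piece_le {K J ε t : ℝ} (hε : 0 < ε) (ht : 0 < t) (ht2 : 8 * (4 ^ 8 * K * J) / ε ≤ t ^ 2) :
    4 ^ 8 * (K / t ^ 2) * J ≤ ε / 8 := by
  rw [show 4 ^ 8 * (K / t ^ 2) * J = (4 ^ 8 * K * J) / t ^ 2 by ring, div_le_iff₀ (by positivity)]
  rw [div_le_iff₀ hε] at ht2
  linarith

/-- Numerics of the FAR class: `Wf · (Q s³ / (s³ D)) ≤ ε/8` for `D = 8 Wf J/ε + 8`, `0 ≤ Q ≤ J`. -/
theorem far_piece_le' {Wf J ε s D Q : ℝ} (hWf : 0 ≤ Wf) (hε : 0 < ε) (hs : 0 < s) (hQ : 0 ≤ Q) (hQJ : Q ≤ J)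
    (hD : D = 8 * (Wf * J) / ε + 8) : Wf * (Q * s ^ 3 / (s ^ 3 * D)) ≤ ε / 8 := by
  have hJ0 : 0 ≤ J := hQ.trans hQJ
  have hD0 : 0 < D := by
    have h0 : 0 ≤ 8 * (Wf * J) / ε := div_nonneg (by positivity) hε.le
    rw [hD]; linarith
  have hs3 : s ^ 3 ≠ 0 := by positivity
  have h1 : Q * s ^ 3 / (s ^ 3 * D) = Q / D := by
    field_simp
  rw [h1]
  calc Wf * (Q / D) ≤ Wf * (J / D) := mul_le_mul_of_nonneg_left (div_le_div_of_nonneg_right hQJ hD0.le) hWf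
    _ = (Wf * J) / (8 * (Wf * J) / ε + 8) := by rw [← mul_div_assoc, hD]
    _ ≤ ε / 8 := div_le_eighth (by positivity) hε (by norm_num)

/-- Numerics of the TAILS: with `T₀ = 16 P/ε + 1`, `P = C₀ Cᵥ² Z₄²` and `T₀ / s⁹ ≤ Nn`,
`C₀ (CᵥZ₄/((1 + s Nn) s⁴)) (CᵥZ₄/s⁴) ≤ ε/16`. -/
theorem tails_piece_le {C₀ Cv Z₄ ε s T₀ Nn : ℝ} (hC₀ : 0 ≤ C₀) (hε : 0 < ε) (hs : 0 < s) (hNn : 0 ≤ Nn)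
    (hT₀ : T₀ = 16 * (C₀ * Cv ^ 2 * Z₄ ^ 2) / ε + 1) (hNr : T₀ / s ^ 9 ≤ Nn) :
    C₀ * (Cv * Z₄ / ((1 + s * Nn) * s ^ 4)) * (Cv * Z₄ / s ^ 4) ≤ ε / 16 := by
  have hP : 0 ≤ C₀ * Cv ^ 2 * Z₄ ^ 2 := by positivity
  have hT₀0 : 0 < T₀ := by rw [hT₀]; positivity
  have h1 : T₀ / s ^ 8 ≤ 1 + s * Nn := by
    have h2 : s * (T₀ / s ^ 9) = T₀ / s ^ 8 := by field_simp
    nlinarith [mul_le_mul_of_nonneg_left hNr hs.le]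
  have hsn : 0 < (1 + s * Nn) * s ^ 8 := by positivity
  have h3 : C₀ * (Cv * Z₄ / ((1 + s * Nn) * s ^ 4)) * (Cv * Z₄ / s ^ 4) =
      (C₀ * Cv ^ 2 * Z₄ ^ 2) / ((1 + s * Nn) * s ^ 8) := by
    field_simp
  rw [h3]
  have h4 : (C₀ * Cv ^ 2 * Z₄ ^ 2) / ((1 + s * Nn) * s ^ 8) ≤ (C₀ * Cv ^ 2 * Z₄ ^ 2) / T₀ := by
    refine div_le_div_of_nonneg_left hP hT₀0 ?_
    have := mul_le_mul_of_nonneg_right h1 (by positivity : 0 ≤ s ^ 8)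
    rwa [div_mul_cancel₀ _ (by positivity : s ^ 8 ≠ 0)] at this
  refine h4.trans ?_
  rw [hT₀]
  exact div_le_sixteenth hP hε

end Bookkeeping

end Summit.QuantumFields.YangMills.Cruxes.IRcof.RunningLandmark

end
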